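import Summits.BirchSwinnertonDyer.Rank1Residual.Additive.X3BranchKummerLayerClasses
import Summits.BirchSwinnertonDyer.Rank1Residual.Additive.X3BranchKummerLocal
import HarnessLib

/-!
# X3, the DEGENERATE rows OFF the sub-locus: the LOCAL behaviour AWAY FROM `p` of the Kummer class
# of an ALGEBRAIC INTEGER — `I_v` fixes every `p`-th root of `b ∈ ℤ̄` dividing a natural number `n`
# with `v ∤ pn`, provided `I_v` fixes `b` (cell `bsd-eis`, seat `bsd-eis-x3` gen 7; sequel of
# `X3BranchKummerLocal.lean` §1 (gen 6: `b = a ∈ ℕ`); route K1 `AdditiveBranchIMC`, crux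
# `GordTwoRankZeroOffCaseOne` — supports only)

HONEST FRAMING (cell `bsd-eis`, `run/shared/lean/pub/bsd-eis/README.md` §4): the programme's target of
record is the full Birch–Swinnerton-Dyer formula for every `E/ℚ` of analytic rank `≤ 1`; this file is
local algebraic number theory for the U-side LOWER BOUND of the degenerate certificate road on the
rows with a prime `ℓ ≡ ±1 (mod 9)` in `Σ₀`: the Kummer class of a `Σ₀`-unit `b` of the first layer
`ℚ_1 = ℚ(ζ₉)⁺` (an algebraic integer dividing the natural number `n = N(b)·(Σ₀-part)`) must be shown
unramified at every `v ∉ Σ₀ ∪ {p}`. THEOREMS ONLY (no `def`, no named fact, no `sorry`); nothing is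
booked; no label, tier or count of record moves.

* `smul_eq_self_of_mem_inertia_of_pow_eq_of_dvd` — `ζ` a primitive `p`-th root of unity, `b, b' ∈ ℚ̄`
  integral over `ℤ` with `b·b' = n ∈ ℕ`, `v ∤ p`, `v ∤ n`, `β^p = b`, `σ ∈ I_v` with `σb = b`: then
  `σβ = β`. Proof as in gen 6: `σβ = ζ^mβ`, `σβ ≡ β (mod 𝔓)` for the prime `𝔓 ∣ v` of `ℤ̄` cut out by
  the tree's embedding, `β ∉ 𝔓` (else `n = β^p·b' ∈ 𝔓`), so `ζ^m ≡ 1 (mod 𝔓)` and `ζ^m = 1`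
  (`𝔓 ∤ p`).

References: [Washington1997] Prop. 2.3 / Lemma 2.12 (method); [NeukirchANT1999] Ch. II (9.6);
[SerreLocalFields1979] Ch. X §3; cell file `run/shared/lean/pub/bsd-eis/x3-MEMO-9.md`.
-/

set_option autoImplicit false

noncomputable section

open scoped Classical AddSubgroup NumberField

namespace Summit.BirchSwinnertonDyer.Rank1Residual.Additive

namespace KummerLayerClasses

open NumberField IsDedekindDomain Field WeierstrassCurve
  Literature.NumberTheory.GaloisRepresentations
  Literature.NumberTheory.EllipticCurves
  Literature.NumberTheory.EllipticCurves.GreenbergSelmer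

variable {p : ℕ} [hp : Fact p.Prime]

/-- **`I_v` fixes every `p`-th root of an algebraic integer `b` dividing a `v`-unit `n ∈ ℕ`, `v ∤ p`,
when it fixes `b`.** `ζ` a primitive `p`-th root of unity in `ℚ̄`; `b, b' ∈ ℚ̄` integral over `ℤ`
with `b·b' = n`, `n ∉ v`, `p ∉ v`; `β^p = b`; `σ ∈ I_v` (the inertia group of the tree's chosen
place above `v`) with `σb = b`. Then `σβ = β`: writing `σβ = ζ^mβ` (possible since `σ` fixes
`b = β^p`), the congruence `σβ ≡ β (mod 𝔓)` gives `(ζ^m − 1)β ∈ 𝔓` with `β ∉ 𝔓` (as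
`β^p·b' = n ∉ 𝔓`), whence `ζ^m = 1` because the `p`-th roots of unity stay distinct modulo
`𝔓 ∤ p`. For `b = a ∈ ℕ` this is gen 6's `smul_eq_self_of_mem_inertia_of_pow_eq`.
[cite: Washington1997, Prop. 2.3 and Lemma 2.12 (method)] [cite: NeukirchANT1999, Ch. II (9.6)] -/
theorem smul_eq_self_of_mem_inertia_of_pow_eq_of_dvd {ζ β b b' : AlgebraicClosure ℚ}
    (hζ : IsPrimitiveRoot ζ p) (hbint : IsIntegral (𝓞 ℚ) b) (hb'int : IsIntegral (𝓞 ℚ) b')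
    {n : ℕ} (hn : b * b' = (n : AlgebraicClosure ℚ)) (hβ : β ^ p = b)
    {v : HeightOneSpectrum (𝓞 ℚ)} (hpv : ((p : ℕ) : 𝓞 ℚ) ∉ v.asIdeal)
    (hnv : ((n : ℕ) : 𝓞 ℚ) ∉ v.asIdeal) {σ : absoluteGaloisGroup ℚ} (hσ : σ ∈ inertia v)
    (hσb : σ • b = b) : σ • β = β := by
  haveI : NeZero p := ⟨hp.out.ne_zero⟩
  have hn0 : n ≠ 0 := by
    rintro rfl
    exact hnv (by simp)
  have hb0 : b ≠ 0 := by
    rintro rfl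
    rw [zero_mul, eq_comm, Nat.cast_eq_zero] at hn
    exact hn0 hn
  set 𝔓 := adicCompletionPrime ℚ v with h𝔓def
  have h𝔓 : 𝔓 ∈ v.primesAbove := adicCompletionPrime_mem_primesAbove ℚ v
  haveI := h𝔓.1
  have hσ' : σ ∈ 𝔓.inertia (absoluteGaloisGroup ℚ) := by
    rw [h𝔓def, inertia_adicCompletionPrime_eq_map_absInertia]; exact hσ
  -- `β`, `b'` and `ζ` as elements of `\bar ℤ`
  have hβint : IsIntegral (𝓞 ℚ) β := IsIntegral.of_pow hp.out.pos (by rw [hβ]; exact hbint)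
  have hζint : IsIntegral (𝓞 ℚ) ζ := (hζ.isIntegral hp.out.pos).tower_top
  set bI : absIntegers (𝓞 ℚ) ℚ := ⟨β, hβint⟩ with hbIdef
  set cI : absIntegers (𝓞 ℚ) ℚ := ⟨b', hb'int⟩ with hcIdef
  set zI : absIntegers (𝓞 ℚ) ℚ := ⟨ζ, hζint⟩ with hzIdef
  have hzI : IsPrimitiveRoot zI p :=
    IsPrimitiveRoot.of_map_of_injective (f := (absIntegers (𝓞 ℚ) ℚ).val) (by exact hζ)
      Subtype.val_injective
  obtain ⟨m, -, hσβ⟩ := exists_smul_eq_pow_mul hζ hb0 hβ hσb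
  have hσbI : σ • bI = zI ^ m * bI := by
    apply Subtype.ext
    rw [integralClosure.coe_smul, Subalgebra.coe_mul, SubmonoidClass.coe_pow]
    exact hσβ
  have hmem : (zI ^ m - 1) * bI ∈ 𝔓 := by
    have h := hσ' bI
    rwa [hσbI, ← sub_one_mul] at h
  -- `β ∉ 𝔓`: otherwise `n = β^p · b' ∈ 𝔓`
  have hbI : bI ∉ 𝔓 := fun h ↦ by
    apply absIntegers.natCast_notMem_of_mem_primesAbove hnv h𝔓
    have hprod : bI ^ p * cI ∈ 𝔓 := Ideal.mul_mem_right _ _ (Ideal.pow_mem_of_mem 𝔓 h p hp.out.pos)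
    have heq : bI ^ p * cI = ((n : ℕ) : absIntegers (𝓞 ℚ) ℚ) := by
      apply Subtype.ext
      rw [Subalgebra.coe_mul, SubmonoidClass.coe_pow]
      change β ^ p * b' = _
      rw [hβ, hn]; simp
    rwa [heq] at hprod
  rcases Ideal.IsPrime.mem_or_mem ‹_› hmem with h1 | h2
  · have h1' : 1 - zI ^ m ∈ 𝔓 := by rwa [← neg_sub, neg_mem_iff]
    have hz1 : zI ^ m = 1 :=
      hzI.pow_eq_one_of_one_sub_pow_mem (absIntegers.natCast_notMem_of_mem_primesAbove hpv h𝔓) h1'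
    have hζ1 : ζ ^ m = 1 := by
      have := congrArg (fun z : absIntegers (𝓞 ℚ) ℚ ↦ (z : AlgebraicClosure ℚ)) hz1
      simpa using this
    rw [hσβ, hζ1, one_mul]
  · exact absurd h2 hbI

end KummerLayerClasses

end Summit.BirchSwinnertonDyer.Rank1Residual.Additive

end
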